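import Mathlib
import Summits.AtomisticToContinuum.FouriersLaw.Theorems.EmbeddedDrudeMourreDrudeDissolutionResonanceStructure
import Summits.AtomisticToContinuum.FouriersLaw.Theorems.EmbeddedDrudeMourreDrudeDissolutionBracketFactorisation
import Summits.AtomisticToContinuum.FouriersLaw.Theorems.EmbeddedDrudeMourreDrudeDissolutionStubExcursionSecondDifferenceConcreteRegularity
import HarnessLib

/-!
# The excursion weight factorises as `W = (S₁S₂)²·B̃` with a smooth bounded cofactor
(crux `EmbeddedDrudeMourre.DrudeDissolution`, item stmt-AtomisticToContinuum-12593; `--supports` file for the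
registered sub-goal `weight_factorisation` of stub B1b″ `stub_excursionSecondDifference` of line
`kinetic-polymer-gas-on-the-time-axis`; closes nothing; lead c13 (process B), 2026-08-17)

WHAT. For a sine polynomial `f = ∑ cᵢ sin((i+1)·)` the free pair excursion weight
`W(p) = Φ²/(ω₁ω₂ω₃ω₄)²·[f(k₁)+f(k₂)−f(k₃)−f(k₄)]²` read at `p = (k₁,(k₃,k₂))` factorises as
`W = (S₁S₂)²·B̃` (`S₁ = sin((k₃−k₁)/2)`, `S₂ = sin((k₃−k₂)/2)`), with
`B̃ = 16·Φ²/(∏ω)²·P²`, `P` the Chebyshev cofactor of `bracket_sinePoly_eq_smooth`. We prove: the identity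
(`weight_eq_prod_sq_mul`), smoothness of `B̃` (`weight_cofactor_contDiff`), its `4π`-periodicity
(`weight_cofactor_periodic`), a generic "smooth + triply periodic ⇒ `C²`-bounded along a frame" lemma
(`periodic3_C2_bounds`), and package everything as the registered `weight_factorisation`.

WHY (role). Input of the `W`-structure bounds `W ≤ C S₁²S₂²`, `|∂W| ≤ C|S₁S₂|(|S₁|+|S₂|)`,
`|∂²W| ≤ C(S₁²+S₂²)` (item (C2-W) of the sup-norm route for B1b″).
-/

noncomputable section

open scoped Topology
open Filter Set

namespace Summit.AtomisticToContinuum.FouriersLaw.Theorems.DrudeDissolution.KineticPolymerGasOnTheTimeAxis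

open Literature.MathematicalPhysics.KineticTheory
open Literature.MathematicalPhysics.KineticTheory.PhononBoltzmann

/-! ### Smooth triply-periodic functions are `C²`-bounded along any frame -/

/-- A `C²` function on `ℝ³`, `T`-periodic in each coordinate, has `|g|`, `|∂_{eᵢ}g|`, `|∂_{eⱼ}∂_{eᵢ}g|`
uniformly bounded for any three directions `eᵢ`. [folklore] -/
theorem periodic3_C2_bounds {g : ℝ × ℝ × ℝ → ℝ} (hg : ContDiff ℝ 2 g) {T : ℝ} (hT : 0 < T)
    (P1 : ∀ q : ℝ × ℝ × ℝ, g (q + (T, 0, 0)) = g q) (P2 : ∀ q : ℝ × ℝ × ℝ, g (q + (0, T, 0)) = g q)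
    (P3 : ∀ q : ℝ × ℝ × ℝ, g (q + (0, 0, T)) = g q) (e : Fin 3 → ℝ × ℝ × ℝ) :
    ∃ C : ℝ, 0 ≤ C ∧ ∀ p : ℝ × ℝ × ℝ, |g p| ≤ C ∧ (∀ i, |fderiv ℝ g p (e i)| ≤ C) ∧
      (∀ i j, |fderiv ℝ (fun q => fderiv ℝ g q (e i)) p (e j)| ≤ C) := by
  obtain ⟨C₀, hC₀⟩ := exists_bound_of_periodic3 hg.continuous hT P1 P2 P3
  have hD1c : Continuous fun p => fderiv ℝ g p := hg.continuous_fderiv (by norm_num)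
  have hD1p : ∀ S : ℝ × ℝ × ℝ, (∀ q, g (q + S) = g q) → ∀ q, fderiv ℝ g (q + S) = fderiv ℝ g q :=
    fun S hS q => fderiv_periodic_vec hS q
  have h1 : ∀ i, ∃ C : ℝ, ∀ p, |fderiv ℝ g p (e i)| ≤ C := fun i =>
    exists_bound_of_periodic3 (f := fun p => fderiv ℝ g p (e i)) (hD1c.clm_apply continuous_const) hT
      (fun q => by simp only [hD1p _ P1 q]) (fun q => by simp only [hD1p _ P2 q])
      (fun q => by simp only [hD1p _ P3 q])
  obtain ⟨C₁, hC₁0, hC₁⟩ := exists_common_bound h1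
  have hgi : ∀ i, ContDiff ℝ 1 fun q => fderiv ℝ g q (e i) := fun i =>
    (hg.fderiv_right (m := 1) (by norm_num)).clm_apply contDiff_const
  have hpi : ∀ i (S : ℝ × ℝ × ℝ), (∀ q, g (q + S) = g q) →
      ∀ q, fderiv ℝ (fun r => fderiv ℝ g r (e i)) (q + S) = fderiv ℝ (fun r => fderiv ℝ g r (e i)) q :=
    fun i S hS q => fderiv_periodic_vec (g := fun r => fderiv ℝ g r (e i)) (fun r => by simp only [hD1p S hS r]) q
  have h2 : ∀ ij : Fin 3 × Fin 3, ∃ C : ℝ, ∀ p,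
      |fderiv ℝ (fun q => fderiv ℝ g q (e ij.1)) p (e ij.2)| ≤ C := fun ij =>
    exists_bound_of_periodic3 (f := fun p => fderiv ℝ (fun q => fderiv ℝ g q (e ij.1)) p (e ij.2))
      (((hgi ij.1).continuous_fderiv one_ne_zero).clm_apply continuous_const) hT
      (fun q => by simp only [hpi _ _ P1 q]) (fun q => by simp only [hpi _ _ P2 q])
      (fun q => by simp only [hpi _ _ P3 q])
  obtain ⟨C₂, hC₂0, hC₂⟩ := exists_common_bound h2
  refine ⟨|C₀| + C₁ + C₂, by positivity, fun p => ⟨?_, fun i => ?_, fun i j => ?_⟩⟩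
  · exact (hC₀ p).trans ((le_abs_self _).trans (by linarith))
  · have := hC₁ i p; have h0 := abs_nonneg C₀; linarith
  · have := hC₂ (i, j) p; have h0 := abs_nonneg C₀; linarith

/-! ### The factorisation -/

section Weight

variable {ω₂ a b : ℝ} (hω : 0 < ω₂) {M : ℕ} {c : Fin M → ℝ} {f : ℝ → ℝ} {S₁ S₂ W B : ℝ × ℝ × ℝ → ℝ}
  (hf : ∀ k, f k = ∑ i, c i * Real.sin (((i : ℕ) + 1 : ℕ) * k))
  (hS₁ : ∀ p : ℝ × ℝ × ℝ, S₁ p = Real.sin ((p.2.1 - p.1) / 2))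
  (hS₂ : ∀ p : ℝ × ℝ × ℝ, S₂ p = Real.sin ((p.2.1 - p.2.2) / 2))
  (hW : ∀ p : ℝ × ℝ × ℝ, W p = vertex a b p.1 p.2.2 p.2.1 ^ 2 /
      (dispersion ω₂ p.1 * dispersion ω₂ p.2.2 * dispersion ω₂ p.2.1 * dispersion ω₂ (p.1 + p.2.2 - p.2.1)) ^ 2 *
    (f p.1 + f p.2.2 - f p.2.1 - f (p.1 + p.2.2 - p.2.1)) ^ 2)
  (hB : ∀ p : ℝ × ℝ × ℝ, B p = 16 * (vertex a b p.1 p.2.2 p.2.1 ^ 2 /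
      (dispersion ω₂ p.1 * dispersion ω₂ p.2.2 * dispersion ω₂ p.2.1 * dispersion ω₂ (p.1 + p.2.2 - p.2.1)) ^ 2) *
    (∑ i, c i * ((Polynomial.Chebyshev.U ℝ (i : ℕ)).eval (Real.cos ((p.2.1 - p.1) / 2)) *
      (Polynomial.Chebyshev.U ℝ (i : ℕ)).eval (Real.cos ((p.2.1 - p.2.2) / 2)) *
      Real.sin ((((i : ℕ) + 1 : ℕ) : ℝ) * (p.1 + p.2.2) / 2))) ^ 2)

include hf hS₁ hS₂ hW hB in
/-- **`W = (S₁S₂)²·B̃`.** [folklore] -/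
theorem weight_eq_prod_sq_mul (p : ℝ × ℝ × ℝ) : W p = (S₁ p * S₂ p) ^ 2 * B p := by
  have hbr := bracket_sinePoly_eq_smooth M c p.1 p.2.2 p.2.1
  rw [hW, hB, hS₁, hS₂, hf, hf, hf, hf, hbr]
  ring

include hω hB in
/-- The cofactor `B̃` is smooth. [folklore] -/
theorem weight_cofactor_contDiff (n : ℕ) : ContDiff ℝ n B := by
  rw [show B = _ from funext hB]
  have hd := resonance_contDiff_dispersion hω n
  have c1 : ContDiff ℝ n fun p : ℝ × ℝ × ℝ => p.1 := contDiff_fst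
  have c3 : ContDiff ℝ n fun p : ℝ × ℝ × ℝ => p.2.1 := contDiff_fst.comp contDiff_snd
  have c2 : ContDiff ℝ n fun p : ℝ × ℝ × ℝ => p.2.2 := contDiff_snd.comp contDiff_snd
  have hE : ContDiff ℝ n fun p : ℝ × ℝ × ℝ => vertex a b p.1 p.2.2 p.2.1 ^ 2 /
      (dispersion ω₂ p.1 * dispersion ω₂ p.2.2 * dispersion ω₂ p.2.1 * dispersion ω₂ (p.1 + p.2.2 - p.2.1)) ^ 2 := by
    refine ((vertex_cell_contDiff a b n).pow 2).div ((((hd.comp c1).mul (hd.comp c2)).mul (hd.comp c3)).mul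
      (hd.comp ((c1.add c2).sub c3)) |>.pow 2) fun p => ?_
    exact pow_ne_zero _ (mul_pos (mul_pos (mul_pos (dispersion_pos hω _) (dispersion_pos hω _))
      (dispersion_pos hω _)) (dispersion_pos hω _)).ne'
  have hU : ∀ i : ℕ, ContDiff ℝ n fun x : ℝ => (Polynomial.Chebyshev.U ℝ i).eval x := fun i => by
    have := Polynomial.contDiff_aeval (𝕜 := ℝ) (Polynomial.Chebyshev.U ℝ i) n
    simpa only [Polynomial.coe_aeval_eq_eval] using this
  have hP : ContDiff ℝ n fun p : ℝ × ℝ × ℝ => ∑ i, c i *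
      ((Polynomial.Chebyshev.U ℝ (i : ℕ)).eval (Real.cos ((p.2.1 - p.1) / 2)) *
        (Polynomial.Chebyshev.U ℝ (i : ℕ)).eval (Real.cos ((p.2.1 - p.2.2) / 2)) *
        Real.sin ((((i : ℕ) + 1 : ℕ) : ℝ) * (p.1 + p.2.2) / 2)) := by
    refine ContDiff.sum fun i _ => contDiff_const.mul ?_
    exact (((hU i).comp (Real.contDiff_cos.comp ((c3.sub c1).div_const 2))).mul
      ((hU i).comp (Real.contDiff_cos.comp ((c3.sub c2).div_const 2)))).mul
      (Real.contDiff_sin.comp ((contDiff_const.mul (c1.add c2)).div_const 2))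
  exact (contDiff_const.mul hE).mul (hP.pow 2)

include hB in
/-- The cofactor `B̃` is `4π`-periodic in each coordinate. [folklore] -/
theorem weight_cofactor_periodic :
    (∀ q : ℝ × ℝ × ℝ, B (q + (4 * Real.pi, 0, 0)) = B q) ∧ (∀ q : ℝ × ℝ × ℝ, B (q + (0, 4 * Real.pi, 0)) = B q) ∧
      (∀ q : ℝ × ℝ × ℝ, B (q + (0, 0, 4 * Real.pi)) = B q) := by
  have hper := dispersion_periodic ω₂
  have hω4 : ∀ x, dispersion ω₂ (x + 4 * Real.pi) = dispersion ω₂ x := fun x => by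
    rw [show x + 4 * Real.pi = x + 2 * Real.pi + 2 * Real.pi by ring, hper, hper]
  have hω4' : ∀ x, dispersion ω₂ (x - 4 * Real.pi) = dispersion ω₂ x := fun x => by
    have := hω4 (x - 4 * Real.pi); rw [sub_add_cancel] at this; exact this.symm
  have hv1 : ∀ x y z, vertex a b (x + 4 * Real.pi) y z = vertex a b x y z := fun x y z => by
    rw [show x + 4 * Real.pi = x + 2 * Real.pi + 2 * Real.pi by ring, vertex_periodic₁, vertex_periodic₁]
  have hv2 : ∀ x y z, vertex a b x (y + 4 * Real.pi) z = vertex a b x y z := fun x y z => by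
    rw [show y + 4 * Real.pi = y + 2 * Real.pi + 2 * Real.pi by ring, vertex_periodic₂, vertex_periodic₂]
  have hv3 : ∀ x y z, vertex a b x y (z + 4 * Real.pi) = vertex a b x y z := fun x y z => by
    rw [show z + 4 * Real.pi = z + 2 * Real.pi + 2 * Real.pi by ring, vertex_periodic₃, vertex_periodic₃]
  have hsin : ∀ (i : ℕ) (x : ℝ), Real.sin (((i + 1 : ℕ) : ℝ) * (x + 4 * Real.pi) / 2) =
      Real.sin (((i + 1 : ℕ) : ℝ) * x / 2) := fun i x => by
    rw [show ((i + 1 : ℕ) : ℝ) * (x + 4 * Real.pi) / 2 = ((i + 1 : ℕ) : ℝ) * x / 2 + ((i + 1 : ℕ) : ℝ) * (2 * Real.pi)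
      by ring]
    exact_mod_cast Real.sin_add_nat_mul_two_pi (((i + 1 : ℕ) : ℝ) * x / 2) (i + 1)
  refine ⟨fun q => ?_, fun q => ?_, fun q => ?_⟩
  · rw [hB, hB]
    simp only [Prod.fst_add, Prod.snd_add, add_zero]
    rw [show q.1 + 4 * Real.pi + q.2.2 - q.2.1 = (q.1 + q.2.2 - q.2.1) + 4 * Real.pi by ring, hω4, hω4, hv1,
      show (q.2.1 - (q.1 + 4 * Real.pi)) / 2 = (q.2.1 - q.1) / 2 - 2 * Real.pi by ring, Real.cos_sub_two_pi,
      show q.1 + 4 * Real.pi + q.2.2 = (q.1 + q.2.2) + 4 * Real.pi by ring]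
    simp only [hsin]
  · rw [hB, hB]
    simp only [Prod.fst_add, Prod.snd_add, add_zero]
    rw [show q.1 + q.2.2 - (q.2.1 + 4 * Real.pi) = (q.1 + q.2.2 - q.2.1) - 4 * Real.pi by ring, hω4', hω4, hv3,
      show (q.2.1 + 4 * Real.pi - q.1) / 2 = (q.2.1 - q.1) / 2 + 2 * Real.pi by ring, Real.cos_add_two_pi,
      show (q.2.1 + 4 * Real.pi - q.2.2) / 2 = (q.2.1 - q.2.2) / 2 + 2 * Real.pi by ring, Real.cos_add_two_pi]
  · rw [hB, hB]
    simp only [Prod.fst_add, Prod.snd_add, add_zero]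
    rw [show q.1 + (q.2.2 + 4 * Real.pi) - q.2.1 = (q.1 + q.2.2 - q.2.1) + 4 * Real.pi by ring, hω4, hω4, hv2,
      show (q.2.1 - (q.2.2 + 4 * Real.pi)) / 2 = (q.2.1 - q.2.2) / 2 - 2 * Real.pi by ring, Real.cos_sub_two_pi,
      show q.1 + (q.2.2 + 4 * Real.pi) = (q.1 + q.2.2) + 4 * Real.pi by ring]
    simp only [hsin]

end Weight

/-- **Registered sub-goal `weight_factorisation` of stub B1b″ (item (C2-W), packaging).** For `ω₂ > 0`, a sine
polynomial profile `f`, and `S₁, S₂, W` as above: there are a `C²` cofactor `B̃` with `W = (S₁S₂)²·B̃` and a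
constant `C ≥ 0` bounding `|B̃|`, `|∂_{eᵢ}B̃|`, `|∂_{eⱼ}∂_{eᵢ}B̃|` everywhere, for any three directions `eᵢ`.
[folklore] -/
theorem weight_factorisation :
    ∀ ω₂ a b : ℝ, 0 < ω₂ → ∀ (M : ℕ) (c : Fin M → ℝ) (f : ℝ → ℝ) (S₁ S₂ W : ℝ × ℝ × ℝ → ℝ),
      (∀ k, f k = ∑ i, c i * Real.sin (((i : ℕ) + 1 : ℕ) * k)) →
      (∀ p : ℝ × ℝ × ℝ, S₁ p = Real.sin ((p.2.1 - p.1) / 2)) →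
      (∀ p : ℝ × ℝ × ℝ, S₂ p = Real.sin ((p.2.1 - p.2.2) / 2)) →
      (∀ p : ℝ × ℝ × ℝ, W p = vertex a b p.1 p.2.2 p.2.1 ^ 2 /
          (dispersion ω₂ p.1 * dispersion ω₂ p.2.2 * dispersion ω₂ p.2.1 * dispersion ω₂ (p.1 + p.2.2 - p.2.1)) ^ 2 *
        (f p.1 + f p.2.2 - f p.2.1 - f (p.1 + p.2.2 - p.2.1)) ^ 2) →
      ∀ e : Fin 3 → ℝ × ℝ × ℝ, ∃ (B : ℝ × ℝ × ℝ → ℝ) (C : ℝ), 0 ≤ C ∧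
        (∀ p, W p = (S₁ p * S₂ p) ^ 2 * B p) ∧ ContDiff ℝ 2 B ∧
        ∀ p : ℝ × ℝ × ℝ, |B p| ≤ C ∧ (∀ i, |fderiv ℝ B p (e i)| ≤ C) ∧
          (∀ i j, |fderiv ℝ (fun q => fderiv ℝ B q (e i)) p (e j)| ≤ C) := by
  intro ω₂ a b hω M c f S₁ S₂ W hf hS₁ hS₂ hW e
  set B : ℝ × ℝ × ℝ → ℝ := fun p => 16 * (vertex a b p.1 p.2.2 p.2.1 ^ 2 /
      (dispersion ω₂ p.1 * dispersion ω₂ p.2.2 * dispersion ω₂ p.2.1 * dispersion ω₂ (p.1 + p.2.2 - p.2.1)) ^ 2) *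
    (∑ i, c i * ((Polynomial.Chebyshev.U ℝ (i : ℕ)).eval (Real.cos ((p.2.1 - p.1) / 2)) *
      (Polynomial.Chebyshev.U ℝ (i : ℕ)).eval (Real.cos ((p.2.1 - p.2.2) / 2)) *
      Real.sin ((((i : ℕ) + 1 : ℕ) : ℝ) * (p.1 + p.2.2) / 2))) ^ 2 with hBdef
  have hB : ∀ p, B p = 16 * (vertex a b p.1 p.2.2 p.2.1 ^ 2 /
      (dispersion ω₂ p.1 * dispersion ω₂ p.2.2 * dispersion ω₂ p.2.1 * dispersion ω₂ (p.1 + p.2.2 - p.2.1)) ^ 2) *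
    (∑ i, c i * ((Polynomial.Chebyshev.U ℝ (i : ℕ)).eval (Real.cos ((p.2.1 - p.1) / 2)) *
      (Polynomial.Chebyshev.U ℝ (i : ℕ)).eval (Real.cos ((p.2.1 - p.2.2) / 2)) *
      Real.sin ((((i : ℕ) + 1 : ℕ) : ℝ) * (p.1 + p.2.2) / 2))) ^ 2 := fun p => rfl
  have hB2 : ContDiff ℝ 2 B := weight_cofactor_contDiff (ω₂ := ω₂) (a := a) (b := b) hω hB 2
  obtain ⟨P1, P2, P3⟩ := weight_cofactor_periodic (ω₂ := ω₂) (a := a) (b := b) hB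
  obtain ⟨C, hC0, hC⟩ := periodic3_C2_bounds hB2 (by positivity : (0 : ℝ) < 4 * Real.pi) P1 P2 P3 e
  exact ⟨B, C, hC0, weight_eq_prod_sq_mul hf hS₁ hS₂ hW hB, hB2, hC⟩

end Summit.AtomisticToContinuum.FouriersLaw.Theorems.DrudeDissolution.KineticPolymerGasOnTheTimeAxis

end
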